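import Literature.AlgebraicGeometry.Morphisms.ProjectiveMorphism
import Literature.AlgebraicGeometry.Morphisms.ProjectiveSpaceOverBasePoints
import Literature.AlgebraicGeometry.Motives.HilbertImageInGrassmannianUniversalFamily
import Mathlib.AlgebraicGeometry.Morphisms.Flat
import Mathlib.AlgebraicGeometry.Morphisms.FiniteType
import Mathlib.AlgebraicGeometry.Morphisms.Separated
import Mathlib.AlgebraicGeometry.Noetherian
import Literature.AlgebraicGeometry.Morphisms.ProjectiveEmbeddingPositiveDimension   -- (ed. 3) ★ (A) closer, F0P1a-p04 (g0), p792037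
import Literature.AlgebraicGeometry.Motives.HilbertSchemeOverBaseLetters             -- (ed. 3) ★ (B1) closer, B-p14 (g20), p792461
import Literature.AlgebraicGeometry.Morphisms.HomSchemePieceOfLayers               -- (ed. 3) ★ (B4) closer, F0P1a-p02 (g0) (P1 p792248, P2, P3)
import Literature.AlgebraicGeometry.Morphisms.GraphFamilyHilbertPolynomial          -- (ed. 3) ★ (C) closer, B-p14 (g20), p792664 (FILE 6 ed. 2)
import Literature.AlgebraicGeometry.Morphisms.HomSchemeGluing                      -- (ed. 3) ★ (D) closer, F0P1a-p01 (g0), p792996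
import Literature.AlgebraicGeometry.Morphisms.IsoLocusOfFlatProper                -- (ed. 4) ★ (B3) closer base, B-p09 (g17) quartet file 4 (proxy F0P1a-p04 (g0))
import Literature.AlgebraicGeometry.Morphisms.HomSchemeClosedLayer                 -- (ed. 5) ★ p795601 (B2) closer, B-p20 (g15) (filer B-p14 (g21))
import HarnessLib

/-!
# SKELETON v0 (HOME-only proposal, B-p14 (g20) for the F-4 lead B-p17 (g15) ∕ F0P1a-plan) — II-b (b4) ASSEMBLY:
# the Hom-scheme `Hom_S(Y, X)` of projective `S`-schemes = letter `stub_IIb_homScheme` v1 c306d77f, from FOUR sub-letters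

HC_CM is proved only modulo the 7 printed citations until rung 0 closes; nothing here bears on a summit statement.  Not a registration:
`sorry` exactly in the sub-letters (A), (B1), (B2), (B3), (B4a), (B4b), (C), (D); `stub_IIb4B4_pieceAssembly` := (B4b) (B4a) and
`stub_IIb4B_piece` (B) := (B4) (B1) (B2) (B3) are THEOREMS, and the head
`stub_IIb_homScheme_holds` is the letter v2 VERBATIM (= v1 with the `∃`-binder `hu ↦ _`), kernel-checked from (A), (B), (C), (D).

THE CUT ([MumfordFogartyKirwan1994] Ch. 0 §5 (c); [FGA] 221 §4.c; Kollár, *Rational curves*, I.1.10): fix a closed `S`-embedding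
`jW : Y ×_S X ↪ 𝐏(ι; S)` (sub-letter A, ★ `IsProjective.prod`).  For a `T`-morphism `φ : Y_T → X_T` its GRAPH FAMILY
`iΓ : Y_T ↪ 𝐏(ι; T)` (★-in-HOME `Morphisms/GraphFamilyEmbedding`: characterised by `iΓ ≫ pr_T = pr_T`, `iΓ ≫ 𝐏(v) = (pr_Y, φ ≫ pr_X) ≫ jW`;
closed, flat) has a Hilbert polynomial at every field point of `T`; the INTERFACE CURRENCY of this cut is «the two letters of
cohomology-and-base-change hold with the polynomial `Q` at every field point of `T`, from Mumford's threshold `B(Q) − 1` on»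
(`LettersQ`, spelled out in each sub-letter; ★ `Modules.hasRank_pushforward_twistMod_of_forall_fieldPoint` turns it into the `HasRank`
hypothesis of the Hilbert scheme ★ `Motives.exists_universal_flat_family`).  Index set of the pieces: the ADMISSIBLE polynomials
`{Q // ∀ e ≥ B(Q) − 1, ⌊Q(e)⌋₊ = Q(e)}` (a Hilbert polynomial takes natural values there; on this set `Q` is determined by its ranks).

* (A) `stub_IIb4A_embedding` — `Y ×_S X ↪ 𝐏(ι; S)` over `S` with `1 ≤ #ι` [★ `IsProjective.prod` + bump `ι ≠ ∅`].
* (B) `stub_IIb4B_piece` — PER ADMISSIBLE `Q`: an `S`-scheme `M_Q` (loc. Noetherian, separated, l.f.t.) with a universal `M_Q`-morphism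
  `u_Q` whose graph family has letters `Q`, universal among `(T, v, φ)` whose graph family has letters `Q` [the (b4) core: ★ Hilb head at
  `Q` × `S`, (b1) closed sub-condition = B-p20's 2A §1 letter, (b2) open graph condition = B-p09's `isIso_pullbackMap_iff_range_subset`,
  (b3) graph dictionary `GraphOfMorphismOver`; F4-T2 proper — to be cut further by the (b4) hands].
* (C) `stub_IIb4C_decomposition` — for every `(T, v, φ)`: a LOCALLY CONSTANT, ADMISSIBLE-valued `P : T → ℚ[X]` with letters `P t` at
  every field point through `t` [★-in-HOME B-p14 (g20): `FlatProjectiveFamilyHilbertPolynomialLocallyConstantScheme` §2 +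
  `…Pieces` §3 (admissibility) at the graph family of `GraphFamilyEmbedding` — dischargeable NOW by paste].
* (D) `stub_IIb4D_gluing` — GLUING: from (A)-data, the family of pieces (B) and the decomposition (C), the letter's `∃ M m u …` with
  `M := ∐_Q M_Q` [Mathlib `Sigma.desc`∕`sigmaOpenCover`∕`Cover.glueMorphisms`, ★-in-HOME `SigmaDescSeparated` for
  separated ∕ l.f.t. ∕ loc. Noetherian, clopen level sets `IsLocallyConstant.isClopen_fiber`, uniqueness via the self-letters of (B) and
  «admissible `Q` is determined by its letters»; M–L, generic bookkeeping].
* HEAD `stub_IIb_homScheme_holds` = letter v1 VERBATIM := (A) ▸ (B) (all `Q`, by `choose`) ▸ (C) ▸ (D).  Namespace of the child line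
  `F4IIbHomScheme` (F0P1a-plan (g0) 21:37:41Z ∕ lead 21:37:55Z): `…Cruxes.HypDel.F4LinearRigidificationII.IIbHomScheme`.

## References
* D. Mumford, J. Fogarty, F. Kirwan, *Geometric Invariant Theory* (3rd ed., 1994), Ch. 0 §5 (c) (p. 23). [MumfordFogartyKirwan1994]
* A. Grothendieck, *FGA*, Sém. Bourbaki 221 (1960/61), §4.c. [FGA]

## EDITION 3 (F0P1a-p03 (g0) for the F-4 lead B-p17 (g15), 2026-08-30T22:4xZ; registrar B-plan1 (g19)) — FIVE FOLDS BY NAME, (B4a)∕(B4b) DELETED, ONE BINDER RENAMED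

Edition 2.1 (= skeleton v0.4, tree sha16 921c584e32895407) is kept byte-identical in every LETTER; this edition (i) DELETES the staffing stubs
`stub_IIb4B4a_pieceData` ∕ `stub_IIb4B4b_pieceUniv` (lead ruling 22:10:29Z∕22:12:42Z: the road of record for (B4) is F0P1a-p02 (g0)'s
`exists_homSchemePiece_of_layers : (B1) → (B2) → (B3) → (B)`, ★ `Morphisms/HomSchemePieceOfLayers` over ★ `Morphisms/HomSchemePiece` and ★
`Morphisms/GraphFamilyBaseChange`; no parent consumes (B4a)∕(B4b)) and makes `stub_IIb4B4_pieceAssembly` a THEOREM by name, and (ii) FOLDS BY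
NAME the four stubs whose closers are ★: (A) `stub_IIb4A_embedding := fun _ _ _ _ _ hq hp => hq.exists_isClosedImmersion_pullback_one_le_card hp`
(★ `Morphisms/ProjectiveEmbeddingPositiveDimension`, F0P1a-p04 (g0)); (B1) `stub_IIb4B1_hilbertLayer := Motives.exists_hilbertScheme_over_letters`
(★ `Motives/HilbertSchemeOverBaseLetters`, B-p14 (g20)); (C) `stub_IIb4C_decomposition := Morphisms.graphFamily_hilbertPolynomial_decomposition`
(★ `Morphisms/GraphFamilyHilbertPolynomial` ed. 2, B-p14 (g20)); (D) `stub_IIb4D_gluing := Morphisms.exists_homScheme_of_pieces` (★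
`Morphisms/HomSchemeGluing`, F0P1a-p01 (g0)) — and (iii) in the (D) LETTER renames the `∃`-binder `(hu : u ≫ pullback.snd p m = pullback.snd q m)` to
`(_ : …)` (a binder-NAME change only, α-equivalent statement — REF∕ref2: census it as such; it removes the tree-side `unusedVariables` warning now
that (D) is proved, exactly as the head letter v2 did).  `sorry` census after this edition = EXACTLY {(B2) `stub_IIb4B2_closedLayer`,
(B3) `stub_IIb4B3_openLayer`}, whose closers are GREEN in HOME and fold at EDITION 4 when their files are ★: (B2)
`Morphisms/HomSchemeClosedLayer.exists_idealSheafData_homSchemeClosedLayer` (B-p20 (g15), after the 2A-β chain); (B3) the 3-line closer over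
`Morphisms/IsoLocusOfFlatProper` (B-p09 (g17) quartet; F0P1a-p04 (g0) cert 60a8503d).  All seven folds are kernel-checked together in F0P1a-p03 (g0)'s by-paste certs `F0/P1a/CERT-F4IIbHomScheme.ALL-IN-mod-B2`
48ab748b (every stub but (B2): trio each) + `…B2-byname` 843b345b ((B2): trio).  Head `stub_IIb_homScheme_holds` untouched (≡ parent tree decl
`…F4LinearRigidificationII.stub_IIb_homScheme`).

## EDITION 4 (F0P1a-p03 (g0) for the F-4 lead, 2026-08-30T23:1xZ; registrar B-plan1 (g20)) — FOLD (B3) BY NAME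

Edition 3 (tree sha16 cc721f7cb00b4aa0) kept byte-identical in every letter; this edition folds BY NAME (B3): (B3)
`stub_IIb4B3_openLayer` by the 3-line closer of F0P1a-p04 (g0) (cert 60a8503d) over B-p09 (g17)'s ★ `Morphisms/IsoLocusOfFlatProper`
(`exists_opens_isIso_morphismRestrict_forall_mem_iff` + `isIso_pullbackMap_iff_range_subset`, [GortzWedhorn2020] Prop. 14.28);
`sorry` census after this edition = EXACTLY {(B2) `stub_IIb4B2_closedLayer`}.
The remaining fold is kernel-checked by paste in `F0/P1a/CERT-F4IIbHomScheme.ALL-IN.F0P1ap03g0.lean` fa56ee03 (sorries 0, head trio) and lands at the next edition when its closer is ★.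

## EDITION 5 (F0P1a-p03 (g0) for the F-4 lead, 2026-08-30; registrar B-plan1 (g20)) — FOLD (B2) BY NAME

The previous edition (tree sha16 234ba47a2df63036) is kept byte-identical in every letter; this edition folds BY NAME (B2): (B2)
`stub_IIb4B2_closedLayer := Morphisms.exists_idealSheafData_homSchemeClosedLayer` (★ `Morphisms/HomSchemeClosedLayer` p795601, B-p20 (g15)'s 2A∕(B2)
chain F8–F15, filer B-p14 (g21));
`sorry` census after this edition = NONE — the child line is sorry-free; head `stub_IIb_homScheme_holds` = [propext, Classical.choice, Quot.sound].
-/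

noncomputable section

set_option backward.isDefEq.respectTransparency false

open CategoryTheory CategoryTheory.Limits CategoryTheory.Abelian AlgebraicGeometry Polynomial
open Literature.AlgebraicGeometry
open Literature.AlgebraicGeometry.Morphisms (IsProjective)
open Literature.AlgebraicGeometry.Modules Literature.AlgebraicGeometry.Modules.SerreTwist
open Literature.Algebra.Homology Literature.Algebra.Homology.LaurentCech Literature.Algebra.Homology.OrderedCech

namespace Summit.HodgeConjecture.CorCM.Cruxes.HypDel.F4LinearRigidificationII.IIbHomScheme

/-! ### (A) the product embedding -/

/-- **(A) `Y ×_S X` embeds in some `𝐏(ι; S)` over `S` with `#ι ≥ 1`** (★ `IsProjective.prod`; if the index type is empty, bump it by a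
linear embedding `𝐏⁰ ↪ 𝐏¹`). [cite: Hartshorne1977, II Ex. 4.9] -/
theorem stub_IIb4A_embedding : ∀ ⦃S Y X : Scheme.{0}⦄ (q : Y ⟶ S) (p : X ⟶ S), IsProjective q → IsProjective p →
    ∃ (ι : Type) (_ : Finite ι) (_ : 1 ≤ Nat.card ι) (jW : pullback q p ⟶ Morphisms.projectiveSpace ι S)
      (_ : IsClosedImmersion jW), jW ≫ Morphisms.projectiveSpaceFst ι S = pullback.fst q p ≫ q := fun _ _ _ _ _ hq hp =>
  hq.exists_isClosedImmersion_pullback_one_le_card hp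

/-! ### (B) the piece of ONE admissible Hilbert polynomial `Q`: four layers (B1)–(B4) -/

/-- **(B1) HILBERT LAYER over `S`, in LETTERS** — for an admissible `Q`: an `S`-scheme `h_Q : HS_Q → S` (locally Noetherian, separated,
locally of finite type; road: `HS_Q := H_Q × S`, `H_Q` = ★ `Motives.exists_universal_flat_family hn Q (B(Q)−1).toNat (fun e ↦ ⌊Q e⌋₊) (adm)`,
`H_Q → Spec ℤ` separated + l.f.t. by ★ `GrassmannianSchemeFiniteType`∕`…Proper` + immersion, J-IIb-3) with a closed FLAT family
`iH : Z_Q ↪ 𝐏(ι; HS_Q)` whose letters are `Q` at every field point (SELF), universal among closed flat families `i : Z ↪ 𝐏(ι; T)` over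
locally Noetherian `S`-schemes `v : T → S` with letters `Q` at every field point: `∃! w : T → HS_Q` over `S` with `Z = 𝐏(w)^* Z_Q`
(letters ⇒ `HasRank ⌊Q e⌋₊` by ★-in-HOME `hasRank_pushforward_twistMod_of_letters` (FILE 3 §3); SELF by FILE 3 §2 pattern).
[cite: MumfordFogartyKirwan1994, Ch. 0 §5 (c) (p. 23)] -/
theorem stub_IIb4B1_hilbertLayer : ∀ ⦃S : Scheme.{0}⦄ [IsLocallyNoetherian S] {ι : Type} (_ : 1 ≤ Nat.card ι) (Q : ℚ[X])
    (_ : ∀ e : ℕ, regularityBound (preHilbertPoly ℚ (Nat.card ι) 0) 0 (preHilbertPoly ℚ (Nat.card ι) 0 - Q) - 1 ≤ (e : ℤ) →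
      ((⌊Q.eval (e : ℚ)⌋₊ : ℕ) : ℚ) = Q.eval (e : ℚ)),
    ∃ (HS : Scheme.{0}) (h : HS ⟶ S) (_ : IsLocallyNoetherian HS) (_ : IsSeparated h) (_ : LocallyOfFiniteType h)
      (ZH : Scheme.{0}) (iH : ZH ⟶ Morphisms.projectiveSpace ι HS) (_ : IsClosedImmersion iH)
      (_ : Flat (iH ≫ Morphisms.projectiveSpaceFst ι HS)),
      -- SELF: the universal family has the letters `Q`
      (∀ ⦃K : Type⦄ [Field K] ⦃X₀ : Scheme.{0}⦄ (k : X₀ ⟶ ZH) (f₀ : X₀ ⟶ Spec (CommRingCat.of K))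
        (x : Spec (CommRingCat.of K) ⟶ HS), IsPullback k f₀ (iH ≫ Morphisms.projectiveSpaceFst ι HS) x →
        ∀ e : ℕ, regularityBound (preHilbertPoly ℚ (Nat.card ι) 0) 0 (preHilbertPoly ℚ (Nat.card ι) 0 - Q) - 1 ≤ (e : ℤ) →
          Subsingleton (CategoryTheory.Abelian.Ext.{1} (unitModule X₀) ((Scheme.Modules.pullback k).obj
            (twistMod (iH ≫ pullback.snd (terminal.from HS) (terminal.from (Morphisms.projectiveSpaceInt ι))) (unitModule _) e)) 1) ∧
          ((Module.finrank Γ(Spec (CommRingCat.of K), ⊤) (SecMod ((Scheme.Modules.pullback k).obj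
            (twistMod (iH ≫ pullback.snd (terminal.from HS) (terminal.from (Morphisms.projectiveSpaceInt ι))) (unitModule _) e))
            f₀.appTop.hom ⊤) : ℕ) : ℚ) = Q.eval (e : ℚ)) ∧
      -- UNIV over `S`
      ∀ ⦃T : Scheme.{0}⦄ [IsLocallyNoetherian T] (v : T ⟶ S) ⦃Z : Scheme.{0}⦄ (i : Z ⟶ Morphisms.projectiveSpace ι T)
        [IsClosedImmersion i] [Flat (i ≫ Morphisms.projectiveSpaceFst ι T)],
        (∀ ⦃K : Type⦄ [Field K] ⦃X₀ : Scheme.{0}⦄ (k : X₀ ⟶ Z) (f₀ : X₀ ⟶ Spec (CommRingCat.of K))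
          (x : Spec (CommRingCat.of K) ⟶ T), IsPullback k f₀ (i ≫ Morphisms.projectiveSpaceFst ι T) x →
          ∀ e : ℕ, regularityBound (preHilbertPoly ℚ (Nat.card ι) 0) 0 (preHilbertPoly ℚ (Nat.card ι) 0 - Q) - 1 ≤ (e : ℤ) →
            Subsingleton (CategoryTheory.Abelian.Ext.{1} (unitModule X₀) ((Scheme.Modules.pullback k).obj
              (twistMod (i ≫ pullback.snd (terminal.from T) (terminal.from (Morphisms.projectiveSpaceInt ι))) (unitModule _) e)) 1) ∧
            ((Module.finrank Γ(Spec (CommRingCat.of K), ⊤) (SecMod ((Scheme.Modules.pullback k).obj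
              (twistMod (i ≫ pullback.snd (terminal.from T) (terminal.from (Morphisms.projectiveSpaceInt ι))) (unitModule _) e))
              f₀.appTop.hom ⊤) : ℕ) : ℚ) = Q.eval (e : ℚ)) →
        ∃! w : T ⟶ HS, w ≫ h = v ∧ ∃ e : Z ⟶ ZH, IsPullback e i iH (Morphisms.projectiveSpaceMap ι w) :=
  Literature.AlgebraicGeometry.Motives.exists_hilbertScheme_over_letters

/-- **(B2) CLOSED LAYER «the family lies inside `W`»** (= B-p20 (g14)'s FILE 2A §1 letter `exists_idealSheafData_containedIn_iff`,
BLUEPRINT b253c292, instantiated at `T := HS`, `i := iH`, `iW := W_{HS} ↪ 𝐏(ι; HS)` the base change of `jW`): there is an ideal sheaf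
`V` on `HS` such that `w : T → HS` (`T` locally Noetherian) kills `V` iff the family pulled back along `w` lies inside `W` pulled back
along `w ≫ h` (containment of kernel ideal sheaves on `𝐏(ι; T)`). [cite: MumfordFogartyKirwan1994, Ch. 0 §5 (c) (p. 23)] -/
theorem stub_IIb4B2_closedLayer : ∀ ⦃S Y X : Scheme.{0}⦄ [IsLocallyNoetherian S] (q : Y ⟶ S) (p : X ⟶ S) {ι : Type}
    (_ : 1 ≤ Nat.card ι) (jW : pullback q p ⟶ Morphisms.projectiveSpace ι S) [IsClosedImmersion jW] (Q : ℚ[X])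
    (_ : ∀ e : ℕ, regularityBound (preHilbertPoly ℚ (Nat.card ι) 0) 0 (preHilbertPoly ℚ (Nat.card ι) 0 - Q) - 1 ≤ (e : ℤ) →
      ((⌊Q.eval (e : ℚ)⌋₊ : ℕ) : ℚ) = Q.eval (e : ℚ))
    ⦃HS : Scheme.{0}⦄ [IsLocallyNoetherian HS] (h : HS ⟶ S) ⦃ZH : Scheme.{0}⦄ (iH : ZH ⟶ Morphisms.projectiveSpace ι HS)
    [IsClosedImmersion iH] [Flat (iH ≫ Morphisms.projectiveSpaceFst ι HS)],
    -- the universal family has the letters `Q` (so `(p_Z)_*𝒪(e)` is locally free with base change, as the 2A letter wants)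
    (∀ ⦃K : Type⦄ [Field K] ⦃X₀ : Scheme.{0}⦄ (k : X₀ ⟶ ZH) (f₀ : X₀ ⟶ Spec (CommRingCat.of K))
      (x : Spec (CommRingCat.of K) ⟶ HS), IsPullback k f₀ (iH ≫ Morphisms.projectiveSpaceFst ι HS) x →
      ∀ e : ℕ, regularityBound (preHilbertPoly ℚ (Nat.card ι) 0) 0 (preHilbertPoly ℚ (Nat.card ι) 0 - Q) - 1 ≤ (e : ℤ) →
        Subsingleton (CategoryTheory.Abelian.Ext.{1} (unitModule X₀) ((Scheme.Modules.pullback k).obj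
          (twistMod (iH ≫ pullback.snd (terminal.from HS) (terminal.from (Morphisms.projectiveSpaceInt ι))) (unitModule _) e)) 1) ∧
        ((Module.finrank Γ(Spec (CommRingCat.of K), ⊤) (SecMod ((Scheme.Modules.pullback k).obj
          (twistMod (iH ≫ pullback.snd (terminal.from HS) (terminal.from (Morphisms.projectiveSpaceInt ι))) (unitModule _) e))
          f₀.appTop.hom ⊤) : ℕ) : ℚ) = Q.eval (e : ℚ)) →
    ∃ V : HS.IdealSheafData, ∀ ⦃T : Scheme.{0}⦄ [IsLocallyNoetherian T] (w : T ⟶ HS),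
      V ≤ w.ker ↔
        (pullback.snd jW (Morphisms.projectiveSpaceMap ι h)).ker.comap (Morphisms.projectiveSpaceMap ι w) ≤
          iH.ker.comap (Morphisms.projectiveSpaceMap ι w) :=
  Literature.AlgebraicGeometry.Morphisms.exists_idealSheafData_homSchemeClosedLayer

/-- **(B3) OPEN LAYER «the family projects isomorphically onto `Y`»** (generic; = B-p09 (g17)'s ★-in-HOME
`exists_opens_isIso_morphismRestrict_forall_mem_iff` + `isIso_pullbackMap_iff_range_subset`, [GortzWedhorn2020] Prop. 14.28): for
`f : Γ → V` proper flat, `q′ : Y′ → V` separated universally closed with `Y′` locally Noetherian and `g : Γ → Y′` over `V`, there is an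
OPEN `U ⊆ V` such that `b : T → V` lands in `U` iff the base change `g_T : Γ_T → Y′_T` is an isomorphism.
[cite: GortzWedhorn2020, Proposition 14.28 (p. 438)] -/
theorem stub_IIb4B3_openLayer : ∀ ⦃V Γ Y' : Scheme.{0}⦄ (f : Γ ⟶ V) (q' : Y' ⟶ V) (g : Γ ⟶ Y') (hg : g ≫ q' = f)
    [IsProper f] [Flat f] [IsSeparated q'] [UniversallyClosed q'] [IsLocallyNoetherian Y'],
    ∃ U : V.Opens, ∀ ⦃T : Scheme.{0}⦄ (b : T ⟶ V),
      IsIso (pullback.map f b q' b g (𝟙 T) (𝟙 V) (by rw [Category.comp_id, hg]) (by rw [Category.comp_id, Category.id_comp])) ↔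
        Set.range b.base ⊆ (U : Set V) := by
  intro V Γ Y' f q' g hg _ _ _ _ _
  obtain ⟨U, hU, hUiff⟩ := Literature.AlgebraicGeometry.Morphisms.exists_opens_isIso_morphismRestrict_forall_mem_iff f q' g hg
  exact ⟨U, fun T b => Literature.AlgebraicGeometry.Morphisms.isIso_pullbackMap_iff_range_subset f q' g hg U hU hUiff b⟩

/-- **(B4) PIECE ASSEMBLY** (ed. 3: a THEOREM by name — F0P1a-p02 (g0)'s ★ `Morphisms/HomSchemePieceOfLayers.exists_homSchemePiece_of_layers`; ed. 2.1's (B4a)∕(B4b) split deleted) — from the Hilbert layer (B1), the closed layer (B2) and the open layer (B3): `M_Q :=` the open `U` (B3,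
with `f := Z_V → V`, `q′ := Y_V → V`, `g :=` the projection of `Z_V ⊆ W_V = Y_V ×_V X_V` to `Y_V`) of the closed `V ⊆ HS_Q` (B2),
`m_Q := M_Q → HS_Q → S`, `u_Q := (Z_{M_Q} → Y_{M_Q})⁻¹ ≫ (Z_{M_Q} → X_{M_Q})` (graph dictionary, B-p20 `GraphOfMorphismOver`:
`comp_eq_of_isIso_comp_fst`, `eq_graph_of_isIso_comp_fst`, `isPullback_graph`, `eq_of_comp_graph_eq`); SELF from (B1)-SELF by base
change (FILE 3 §1∕§2 pattern); UNIV: letters `Q` ⇒ (B1) gives `w₀ : T → HS_Q` with the graph family = pullback of `Z_Q`; the graph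
lies in `W_T` ⇒ `w₀` kills `V` ((B2) ←) ⇒ factors through `V`; the graph projects isomorphically onto `Y_T` ⇒ lands in `U` ((B3) →);
uniqueness from (B1)'s `∃!` and «graphs with the same image coincide». [cite: MumfordFogartyKirwan1994, Ch. 0 §5 (c) (p. 23)] -/
theorem stub_IIb4B4_pieceAssembly
    (hB1 : type_of% stub_IIb4B1_hilbertLayer) (hB2 : type_of% stub_IIb4B2_closedLayer) (hB3 : type_of% stub_IIb4B3_openLayer) : ∀ ⦃S Y X : Scheme.{0}⦄ [IsLocallyNoetherian S] (q : Y ⟶ S) (p : X ⟶ S) [Flat q]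
    (_ : IsProjective q) (_ : IsProjective p) {ι : Type} (_ : 1 ≤ Nat.card ι)
    (jW : pullback q p ⟶ Morphisms.projectiveSpace ι S) [IsClosedImmersion jW]
    (_ : jW ≫ Morphisms.projectiveSpaceFst ι S = pullback.fst q p ≫ q) (Q : ℚ[X])
    (_ : ∀ e : ℕ, regularityBound (preHilbertPoly ℚ (Nat.card ι) 0) 0 (preHilbertPoly ℚ (Nat.card ι) 0 - Q) - 1 ≤ (e : ℤ) →
      ((⌊Q.eval (e : ℚ)⌋₊ : ℕ) : ℚ) = Q.eval (e : ℚ)),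
    ∃ (M : Scheme.{0}) (m : M ⟶ S) (_ : IsLocallyNoetherian M) (_ : IsSeparated m) (_ : LocallyOfFiniteType m)
      (u : pullback q m ⟶ pullback p m) (_ : u ≫ pullback.snd p m = pullback.snd q m),
      -- (self) the graph family of `u` has the letters `Q` at every field point of `M`
      (∀ (hw : pullback.fst q m ≫ q = (u ≫ pullback.fst p m) ≫ p) (iΓ : pullback q m ⟶ Morphisms.projectiveSpace ι M),
        iΓ ≫ Morphisms.projectiveSpaceFst ι M = pullback.snd q m →
        iΓ ≫ Morphisms.projectiveSpaceMap ι m = pullback.lift (pullback.fst q m) (u ≫ pullback.fst p m) hw ≫ jW →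
        ∀ ⦃K : Type⦄ [Field K] ⦃X₀ : Scheme.{0}⦄ (k : X₀ ⟶ pullback q m) (f₀ : X₀ ⟶ Spec (CommRingCat.of K))
          (x : Spec (CommRingCat.of K) ⟶ M), IsPullback k f₀ (iΓ ≫ Morphisms.projectiveSpaceFst ι M) x →
          ∀ e : ℕ, regularityBound (preHilbertPoly ℚ (Nat.card ι) 0) 0 (preHilbertPoly ℚ (Nat.card ι) 0 - Q) - 1 ≤ (e : ℤ) →
            Subsingleton (CategoryTheory.Abelian.Ext.{1} (unitModule X₀) ((Scheme.Modules.pullback k).obj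
              (twistMod (iΓ ≫ pullback.snd (terminal.from M) (terminal.from (Morphisms.projectiveSpaceInt ι))) (unitModule _) e)) 1) ∧
            ((Module.finrank Γ(Spec (CommRingCat.of K), ⊤) (SecMod ((Scheme.Modules.pullback k).obj
              (twistMod (iΓ ≫ pullback.snd (terminal.from M) (terminal.from (Morphisms.projectiveSpaceInt ι))) (unitModule _) e))
              f₀.appTop.hom ⊤) : ℕ) : ℚ) = Q.eval (e : ℚ)) ∧
      -- (univ) universal among `(T, v, φ)` whose graph family has the letters `Q`
      ∀ ⦃T : Scheme.{0}⦄ [IsLocallyNoetherian T] (v : T ⟶ S) (φ : pullback q v ⟶ pullback p v)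
        (hφ : φ ≫ pullback.snd p v = pullback.snd q v),
        (∀ (hw : pullback.fst q v ≫ q = (φ ≫ pullback.fst p v) ≫ p) (iΓ : pullback q v ⟶ Morphisms.projectiveSpace ι T),
          iΓ ≫ Morphisms.projectiveSpaceFst ι T = pullback.snd q v →
          iΓ ≫ Morphisms.projectiveSpaceMap ι v = pullback.lift (pullback.fst q v) (φ ≫ pullback.fst p v) hw ≫ jW →
          ∀ ⦃K : Type⦄ [Field K] ⦃X₀ : Scheme.{0}⦄ (k : X₀ ⟶ pullback q v) (f₀ : X₀ ⟶ Spec (CommRingCat.of K))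
            (x : Spec (CommRingCat.of K) ⟶ T), IsPullback k f₀ (iΓ ≫ Morphisms.projectiveSpaceFst ι T) x →
            ∀ e : ℕ, regularityBound (preHilbertPoly ℚ (Nat.card ι) 0) 0 (preHilbertPoly ℚ (Nat.card ι) 0 - Q) - 1 ≤ (e : ℤ) →
              Subsingleton (CategoryTheory.Abelian.Ext.{1} (unitModule X₀) ((Scheme.Modules.pullback k).obj
                (twistMod (iΓ ≫ pullback.snd (terminal.from T) (terminal.from (Morphisms.projectiveSpaceInt ι))) (unitModule _) e)) 1) ∧
              ((Module.finrank Γ(Spec (CommRingCat.of K), ⊤) (SecMod ((Scheme.Modules.pullback k).obj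
                (twistMod (iΓ ≫ pullback.snd (terminal.from T) (terminal.from (Morphisms.projectiveSpaceInt ι))) (unitModule _) e))
                f₀.appTop.hom ⊤) : ℕ) : ℚ) = Q.eval (e : ℚ)) →
        ∃! w : T ⟶ M, ∃ (hw : w ≫ m = v),
          φ ≫ pullback.map p v p m (𝟙 X) w (𝟙 S) (by simp) (by simpa using hw.symm) =
            pullback.map q v q m (𝟙 Y) w (𝟙 S) (by simp) (by simpa using hw.symm) ≫ u :=
  Literature.AlgebraicGeometry.Morphisms.exists_homSchemePiece_of_layers hB1 hB2 hB3
/-- **(B) THE PIECE `M_Q`** (now a THEOREM: (B4) applied to (B1) (B2) (B3)) — for an admissible `Q`: an `S`-scheme `m_Q : M_Q → S` (locally Noetherian, separated, locally of finite type)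
with an `M_Q`-morphism `u_Q : Y_{M_Q} → X_{M_Q}` such that (self) the graph family of `u_Q` has the letters `Q` at every field point
of `M_Q`, and (univ) every `(T, v, φ)` (`T` locally Noetherian) whose graph family has the letters `Q` at every field point of `T` is the
base change of `u_Q` along a UNIQUE `w : T → M_Q` over `S`.  Road: `M_Q ⊂ V_Q ⊂ H_Q × S` with `H_Q` the Hilbert scheme of `Q` in
`𝐏(ι)` (★ `Motives.exists_universal_flat_family`, `R e := ⌊Q(e)⌋₊`, `e₁ := (B(Q) − 1).toNat`; letters → `HasRank` by ★
`Modules.hasRank_pushforward_twistMod_of_forall_fieldPoint`), `V_Q` the CLOSED locus «universal family ⊂ W» ((b1), B-p20 (g14) 2A §1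
letter `exists_idealSheafData_containedIn_iff`), `M_Q ⊂ V_Q` the OPEN locus «universal family → Y is an isomorphism» ((b2), B-p09 (g17)
`exists_opens_isIso_morphismRestrict_forall_mem_iff` + `isIso_pullbackMap_iff_range_subset`), `u_Q` and the bijection by the graph
dictionary ((b3), B-p20 `GraphOfMorphismOver`: `eq_graph_of_isIso_comp_fst`, `isPullback_graph`, `eq_of_comp_graph_eq`).
[cite: MumfordFogartyKirwan1994, Ch. 0 §5 (c) (p. 23)] -/
theorem stub_IIb4B_piece : ∀ ⦃S Y X : Scheme.{0}⦄ [IsLocallyNoetherian S] (q : Y ⟶ S) (p : X ⟶ S) [Flat q]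
    (_ : IsProjective q) (_ : IsProjective p) {ι : Type} (_ : 1 ≤ Nat.card ι)
    (jW : pullback q p ⟶ Morphisms.projectiveSpace ι S) [IsClosedImmersion jW]
    (_ : jW ≫ Morphisms.projectiveSpaceFst ι S = pullback.fst q p ≫ q) (Q : ℚ[X])
    (_ : ∀ e : ℕ, regularityBound (preHilbertPoly ℚ (Nat.card ι) 0) 0 (preHilbertPoly ℚ (Nat.card ι) 0 - Q) - 1 ≤ (e : ℤ) →
      ((⌊Q.eval (e : ℚ)⌋₊ : ℕ) : ℚ) = Q.eval (e : ℚ)),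
    ∃ (M : Scheme.{0}) (m : M ⟶ S) (_ : IsLocallyNoetherian M) (_ : IsSeparated m) (_ : LocallyOfFiniteType m)
      (u : pullback q m ⟶ pullback p m) (_ : u ≫ pullback.snd p m = pullback.snd q m),
      -- (self) the graph family of `u` has the letters `Q` at every field point of `M`
      (∀ (hw : pullback.fst q m ≫ q = (u ≫ pullback.fst p m) ≫ p) (iΓ : pullback q m ⟶ Morphisms.projectiveSpace ι M),
        iΓ ≫ Morphisms.projectiveSpaceFst ι M = pullback.snd q m →
        iΓ ≫ Morphisms.projectiveSpaceMap ι m = pullback.lift (pullback.fst q m) (u ≫ pullback.fst p m) hw ≫ jW →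
        ∀ ⦃K : Type⦄ [Field K] ⦃X₀ : Scheme.{0}⦄ (k : X₀ ⟶ pullback q m) (f₀ : X₀ ⟶ Spec (CommRingCat.of K))
          (x : Spec (CommRingCat.of K) ⟶ M), IsPullback k f₀ (iΓ ≫ Morphisms.projectiveSpaceFst ι M) x →
          ∀ e : ℕ, regularityBound (preHilbertPoly ℚ (Nat.card ι) 0) 0 (preHilbertPoly ℚ (Nat.card ι) 0 - Q) - 1 ≤ (e : ℤ) →
            Subsingleton (CategoryTheory.Abelian.Ext.{1} (unitModule X₀) ((Scheme.Modules.pullback k).obj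
              (twistMod (iΓ ≫ pullback.snd (terminal.from M) (terminal.from (Morphisms.projectiveSpaceInt ι))) (unitModule _) e)) 1) ∧
            ((Module.finrank Γ(Spec (CommRingCat.of K), ⊤) (SecMod ((Scheme.Modules.pullback k).obj
              (twistMod (iΓ ≫ pullback.snd (terminal.from M) (terminal.from (Morphisms.projectiveSpaceInt ι))) (unitModule _) e))
              f₀.appTop.hom ⊤) : ℕ) : ℚ) = Q.eval (e : ℚ)) ∧
      -- (univ) universal among `(T, v, φ)` whose graph family has the letters `Q`
      ∀ ⦃T : Scheme.{0}⦄ [IsLocallyNoetherian T] (v : T ⟶ S) (φ : pullback q v ⟶ pullback p v)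
        (hφ : φ ≫ pullback.snd p v = pullback.snd q v),
        (∀ (hw : pullback.fst q v ≫ q = (φ ≫ pullback.fst p v) ≫ p) (iΓ : pullback q v ⟶ Morphisms.projectiveSpace ι T),
          iΓ ≫ Morphisms.projectiveSpaceFst ι T = pullback.snd q v →
          iΓ ≫ Morphisms.projectiveSpaceMap ι v = pullback.lift (pullback.fst q v) (φ ≫ pullback.fst p v) hw ≫ jW →
          ∀ ⦃K : Type⦄ [Field K] ⦃X₀ : Scheme.{0}⦄ (k : X₀ ⟶ pullback q v) (f₀ : X₀ ⟶ Spec (CommRingCat.of K))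
            (x : Spec (CommRingCat.of K) ⟶ T), IsPullback k f₀ (iΓ ≫ Morphisms.projectiveSpaceFst ι T) x →
            ∀ e : ℕ, regularityBound (preHilbertPoly ℚ (Nat.card ι) 0) 0 (preHilbertPoly ℚ (Nat.card ι) 0 - Q) - 1 ≤ (e : ℤ) →
              Subsingleton (CategoryTheory.Abelian.Ext.{1} (unitModule X₀) ((Scheme.Modules.pullback k).obj
                (twistMod (iΓ ≫ pullback.snd (terminal.from T) (terminal.from (Morphisms.projectiveSpaceInt ι))) (unitModule _) e)) 1) ∧
              ((Module.finrank Γ(Spec (CommRingCat.of K), ⊤) (SecMod ((Scheme.Modules.pullback k).obj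
                (twistMod (iΓ ≫ pullback.snd (terminal.from T) (terminal.from (Morphisms.projectiveSpaceInt ι))) (unitModule _) e))
                f₀.appTop.hom ⊤) : ℕ) : ℚ) = Q.eval (e : ℚ)) →
        ∃! w : T ⟶ M, ∃ (hw : w ≫ m = v),
          φ ≫ pullback.map p v p m (𝟙 X) w (𝟙 S) (by simp) (by simpa using hw.symm) =
            pullback.map q v q m (𝟙 Y) w (𝟙 S) (by simp) (by simpa using hw.symm) ≫ u :=
  stub_IIb4B4_pieceAssembly stub_IIb4B1_hilbertLayer stub_IIb4B2_closedLayer stub_IIb4B3_openLayer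

/-! ### (C) the decomposition of a test scheme by the Hilbert polynomial of the graph -/

/-- **(C) DECOMPOSITION** — for every `(T, v, φ)` there is a LOCALLY CONSTANT `P : T → ℚ[X]` with ADMISSIBLE values such that the graph
family of `φ` has the letters `P t` at every field point through `t`.  Discharge: ★-in-HOME `GraphFamilyEmbedding`
(`isClosedImmersion_graphFamily`, `flat_graphFamily_fst`) + `FlatProjectiveFamilyHilbertPolynomialLocallyConstantScheme`
(`exists_isLocallyConstant_hilbertPolynomial_scheme`) + `…Pieces` §3∕§4 (admissibility: the value at `t` is a dimension).
[cite: Hartshorne1977, III Thm. 9.9 (p. 261)] [cite: EGAIII2, 7.9.11] -/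
theorem stub_IIb4C_decomposition : ∀ ⦃S Y X : Scheme.{0}⦄ [IsLocallyNoetherian S] (q : Y ⟶ S) (p : X ⟶ S) [Flat q]
    {ι : Type} (_ : 1 ≤ Nat.card ι) (jW : pullback q p ⟶ Morphisms.projectiveSpace ι S) [IsClosedImmersion jW]
    (_ : jW ≫ Morphisms.projectiveSpaceFst ι S = pullback.fst q p ≫ q)
    ⦃T : Scheme.{0}⦄ [IsLocallyNoetherian T] (v : T ⟶ S) (φ : pullback q v ⟶ pullback p v)
    (_ : φ ≫ pullback.snd p v = pullback.snd q v) (hw : pullback.fst q v ≫ q = (φ ≫ pullback.fst p v) ≫ p)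
    (iΓ : pullback q v ⟶ Morphisms.projectiveSpace ι T), iΓ ≫ Morphisms.projectiveSpaceFst ι T = pullback.snd q v →
    iΓ ≫ Morphisms.projectiveSpaceMap ι v = pullback.lift (pullback.fst q v) (φ ≫ pullback.fst p v) hw ≫ jW →
    ∃ P : T → ℚ[X], IsLocallyConstant P ∧
      (∀ t : T, ∀ e : ℕ, regularityBound (preHilbertPoly ℚ (Nat.card ι) 0) 0 (preHilbertPoly ℚ (Nat.card ι) 0 - P t) - 1 ≤ (e : ℤ) →
        ((⌊(P t).eval (e : ℚ)⌋₊ : ℕ) : ℚ) = (P t).eval (e : ℚ)) ∧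
      ∀ ⦃K : Type⦄ [Field K] ⦃X₀ : Scheme.{0}⦄ (k : X₀ ⟶ pullback q v) (f₀ : X₀ ⟶ Spec (CommRingCat.of K))
        (x : Spec (CommRingCat.of K) ⟶ T), IsPullback k f₀ (iΓ ≫ Morphisms.projectiveSpaceFst ι T) x →
        ∀ t : T, t ∈ Set.range x.base →
        ∀ e : ℕ, regularityBound (preHilbertPoly ℚ (Nat.card ι) 0) 0 (preHilbertPoly ℚ (Nat.card ι) 0 - P t) - 1 ≤ (e : ℤ) →
          Subsingleton (CategoryTheory.Abelian.Ext.{1} (unitModule X₀) ((Scheme.Modules.pullback k).obj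
            (twistMod (iΓ ≫ pullback.snd (terminal.from T) (terminal.from (Morphisms.projectiveSpaceInt ι))) (unitModule _) e)) 1) ∧
          ((Module.finrank Γ(Spec (CommRingCat.of K), ⊤) (SecMod ((Scheme.Modules.pullback k).obj
            (twistMod (iΓ ≫ pullback.snd (terminal.from T) (terminal.from (Morphisms.projectiveSpaceInt ι))) (unitModule _) e))
            f₀.appTop.hom ⊤) : ℕ) : ℚ) = (P t).eval (e : ℚ) :=
  Literature.AlgebraicGeometry.Morphisms.graphFamily_hilbertPolynomial_decomposition

/-! ### (D) gluing the pieces over the clopen decomposition -/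

/-- **(D) GLUING** — with the embedding (A), a family of pieces `(M_Q, m_Q, u_Q)` satisfying (B) for every admissible `Q`, and the
decomposition (C), the disjoint union `M := ∐_Q M_Q` with `u` glued from the `u_Q` represents ALL `T`-morphisms: the letter's
`∃ M m u, ∀ T v φ, ∃! w …`.  Road: `M` locally Noetherian ∕ separated ∕ l.f.t. by ★-in-HOME `SigmaDescSeparated`
(`isLocallyNoetherian_sigma`, `isSeparated_sigmaDesc`, `locallyOfFiniteType_sigmaDesc`); `u` by Mathlib `Scheme.Cover.glueMorphisms` on
`Scheme.Pullback.openCoverOfRight (sigmaOpenCover M_) q m` (overlaps empty for `Q ≠ Q′`, `isEmpty_pullback_sigmaι_of_ne`); existence of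
`w` by gluing the `w_Q` of (B)-univ over the clopen cover `{P = Q}` of `T` given by (C) (`IsLocallyConstant.isClopen_fiber`,
`Scheme.openCoverOfISupEqTop`); uniqueness: a second `w′` sends `{P = Q}` into the summand `M_Q` because the pulled-back `u` has the
letters of the summand ((B)-self transported by base change) and an admissible polynomial is determined by its letters at one field
point, then (B)-univ on each piece and `Cover.hom_ext`. [cite: MumfordFogartyKirwan1994, Ch. 0 §5 (c) (p. 23)] -/
theorem stub_IIb4D_gluing : ∀ ⦃S Y X : Scheme.{0}⦄ [IsLocallyNoetherian S] (q : Y ⟶ S) (p : X ⟶ S) [Flat q]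
    (_ : IsProjective q) (_ : IsProjective p) {ι : Type} (_ : 1 ≤ Nat.card ι)
    (jW : pullback q p ⟶ Morphisms.projectiveSpace ι S) [IsClosedImmersion jW]
    (_ : jW ≫ Morphisms.projectiveSpaceFst ι S = pullback.fst q p ≫ q)
    -- the pieces, indexed by the admissible polynomials
    (M_ : {Q : ℚ[X] // ∀ e : ℕ, regularityBound (preHilbertPoly ℚ (Nat.card ι) 0) 0 (preHilbertPoly ℚ (Nat.card ι) 0 - Q) - 1 ≤ (e : ℤ) →
      ((⌊Q.eval (e : ℚ)⌋₊ : ℕ) : ℚ) = Q.eval (e : ℚ)} → Scheme.{0})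
    (m_ : ∀ Q, M_ Q ⟶ S) (_ : ∀ Q, IsLocallyNoetherian (M_ Q)) (_ : ∀ Q, IsSeparated (m_ Q)) (_ : ∀ Q, LocallyOfFiniteType (m_ Q))
    (u_ : ∀ Q, pullback q (m_ Q) ⟶ pullback p (m_ Q)) (_ : ∀ Q, u_ Q ≫ pullback.snd p (m_ Q) = pullback.snd q (m_ Q))
    (_ : ∀ Q, (∀ (hw : pullback.fst q (m_ Q) ≫ q = (u_ Q ≫ pullback.fst p (m_ Q)) ≫ p)
        (iΓ : pullback q (m_ Q) ⟶ Morphisms.projectiveSpace ι (M_ Q)),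
        iΓ ≫ Morphisms.projectiveSpaceFst ι (M_ Q) = pullback.snd q (m_ Q) →
        iΓ ≫ Morphisms.projectiveSpaceMap ι (m_ Q) = pullback.lift (pullback.fst q (m_ Q)) (u_ Q ≫ pullback.fst p (m_ Q)) hw ≫ jW →
        ∀ ⦃K : Type⦄ [Field K] ⦃X₀ : Scheme.{0}⦄ (k : X₀ ⟶ pullback q (m_ Q)) (f₀ : X₀ ⟶ Spec (CommRingCat.of K))
          (x : Spec (CommRingCat.of K) ⟶ M_ Q), IsPullback k f₀ (iΓ ≫ Morphisms.projectiveSpaceFst ι (M_ Q)) x →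
          ∀ e : ℕ, regularityBound (preHilbertPoly ℚ (Nat.card ι) 0) 0 (preHilbertPoly ℚ (Nat.card ι) 0 - Q.1) - 1 ≤ (e : ℤ) →
            Subsingleton (CategoryTheory.Abelian.Ext.{1} (unitModule X₀) ((Scheme.Modules.pullback k).obj
              (twistMod (iΓ ≫ pullback.snd (terminal.from (M_ Q)) (terminal.from (Morphisms.projectiveSpaceInt ι))) (unitModule _) e)) 1) ∧
            ((Module.finrank Γ(Spec (CommRingCat.of K), ⊤) (SecMod ((Scheme.Modules.pullback k).obj
              (twistMod (iΓ ≫ pullback.snd (terminal.from (M_ Q)) (terminal.from (Morphisms.projectiveSpaceInt ι))) (unitModule _) e))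
              f₀.appTop.hom ⊤) : ℕ) : ℚ) = Q.1.eval (e : ℚ)) ∧
      ∀ ⦃T : Scheme.{0}⦄ [IsLocallyNoetherian T] (v : T ⟶ S) (φ : pullback q v ⟶ pullback p v)
        (hφ : φ ≫ pullback.snd p v = pullback.snd q v),
        (∀ (hw : pullback.fst q v ≫ q = (φ ≫ pullback.fst p v) ≫ p) (iΓ : pullback q v ⟶ Morphisms.projectiveSpace ι T),
          iΓ ≫ Morphisms.projectiveSpaceFst ι T = pullback.snd q v →
          iΓ ≫ Morphisms.projectiveSpaceMap ι v = pullback.lift (pullback.fst q v) (φ ≫ pullback.fst p v) hw ≫ jW →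
          ∀ ⦃K : Type⦄ [Field K] ⦃X₀ : Scheme.{0}⦄ (k : X₀ ⟶ pullback q v) (f₀ : X₀ ⟶ Spec (CommRingCat.of K))
            (x : Spec (CommRingCat.of K) ⟶ T), IsPullback k f₀ (iΓ ≫ Morphisms.projectiveSpaceFst ι T) x →
            ∀ e : ℕ, regularityBound (preHilbertPoly ℚ (Nat.card ι) 0) 0 (preHilbertPoly ℚ (Nat.card ι) 0 - Q.1) - 1 ≤ (e : ℤ) →
              Subsingleton (CategoryTheory.Abelian.Ext.{1} (unitModule X₀) ((Scheme.Modules.pullback k).obj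
                (twistMod (iΓ ≫ pullback.snd (terminal.from T) (terminal.from (Morphisms.projectiveSpaceInt ι))) (unitModule _) e)) 1) ∧
              ((Module.finrank Γ(Spec (CommRingCat.of K), ⊤) (SecMod ((Scheme.Modules.pullback k).obj
                (twistMod (iΓ ≫ pullback.snd (terminal.from T) (terminal.from (Morphisms.projectiveSpaceInt ι))) (unitModule _) e))
                f₀.appTop.hom ⊤) : ℕ) : ℚ) = Q.1.eval (e : ℚ)) →
        ∃! w : T ⟶ M_ Q, ∃ (hw : w ≫ m_ Q = v),
          φ ≫ pullback.map p v p (m_ Q) (𝟙 X) w (𝟙 S) (by simp) (by simpa using hw.symm) =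
            pullback.map q v q (m_ Q) (𝟙 Y) w (𝟙 S) (by simp) (by simpa using hw.symm) ≫ u_ Q)
    -- the decomposition (C) of every test morphism
    (_ : ∀ ⦃T : Scheme.{0}⦄ [IsLocallyNoetherian T] (v : T ⟶ S) (φ : pullback q v ⟶ pullback p v)
      (_ : φ ≫ pullback.snd p v = pullback.snd q v) (hw : pullback.fst q v ≫ q = (φ ≫ pullback.fst p v) ≫ p)
      (iΓ : pullback q v ⟶ Morphisms.projectiveSpace ι T), iΓ ≫ Morphisms.projectiveSpaceFst ι T = pullback.snd q v →
      iΓ ≫ Morphisms.projectiveSpaceMap ι v = pullback.lift (pullback.fst q v) (φ ≫ pullback.fst p v) hw ≫ jW →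
      ∃ P : T → ℚ[X], IsLocallyConstant P ∧
        (∀ t : T, ∀ e : ℕ, regularityBound (preHilbertPoly ℚ (Nat.card ι) 0) 0 (preHilbertPoly ℚ (Nat.card ι) 0 - P t) - 1 ≤ (e : ℤ) →
          ((⌊(P t).eval (e : ℚ)⌋₊ : ℕ) : ℚ) = (P t).eval (e : ℚ)) ∧
        ∀ ⦃K : Type⦄ [Field K] ⦃X₀ : Scheme.{0}⦄ (k : X₀ ⟶ pullback q v) (f₀ : X₀ ⟶ Spec (CommRingCat.of K))
          (x : Spec (CommRingCat.of K) ⟶ T), IsPullback k f₀ (iΓ ≫ Morphisms.projectiveSpaceFst ι T) x →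
          ∀ t : T, t ∈ Set.range x.base →
          ∀ e : ℕ, regularityBound (preHilbertPoly ℚ (Nat.card ι) 0) 0 (preHilbertPoly ℚ (Nat.card ι) 0 - P t) - 1 ≤ (e : ℤ) →
            Subsingleton (CategoryTheory.Abelian.Ext.{1} (unitModule X₀) ((Scheme.Modules.pullback k).obj
              (twistMod (iΓ ≫ pullback.snd (terminal.from T) (terminal.from (Morphisms.projectiveSpaceInt ι))) (unitModule _) e)) 1) ∧
            ((Module.finrank Γ(Spec (CommRingCat.of K), ⊤) (SecMod ((Scheme.Modules.pullback k).obj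
              (twistMod (iΓ ≫ pullback.snd (terminal.from T) (terminal.from (Morphisms.projectiveSpaceInt ι))) (unitModule _) e))
              f₀.appTop.hom ⊤) : ℕ) : ℚ) = (P t).eval (e : ℚ)),
    ∃ (M : Scheme.{0}) (m : M ⟶ S) (_ : IsLocallyNoetherian M) (_ : IsSeparated m) (_ : LocallyOfFiniteType m)
      (u : pullback q m ⟶ pullback p m) (_ : u ≫ pullback.snd p m = pullback.snd q m),
      ∀ ⦃T : Scheme.{0}⦄ [IsLocallyNoetherian T] (v : T ⟶ S) (φ : pullback q v ⟶ pullback p v)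
        (hφ : φ ≫ pullback.snd p v = pullback.snd q v),
        ∃! w : T ⟶ M, ∃ (hw : w ≫ m = v),
          φ ≫ pullback.map p v p m (𝟙 X) w (𝟙 S) (by simp) (by simpa using hw.symm) =
            pullback.map q v q m (𝟙 Y) w (𝟙 S) (by simp) (by simpa using hw.symm) ≫ u :=
  Literature.AlgebraicGeometry.Morphisms.exists_homScheme_of_pieces

/-! ### HEAD — the letter `stub_IIb_homScheme` v2 (B-p17 (g15) 6c82be24 = v1 c306d77f with the `∃`-binder `hu ↦ _`) VERBATIM, from (A)–(D) -/

/-- **II-b — the Hom-scheme of projective `S`-schemes** (letter v2 `B-provers/B-p17/g15/F4-IIb-HomScheme.letter-v2.B-p17g15.lean`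
VERBATIM), proved from the sub-letters (A)–(D): fix the embedding (A); take the pieces (B) for all admissible `Q` (by choice); glue (D)
using the decomposition (C). [cite: MumfordFogartyKirwan1994, Ch. 0 §5 (c) (p. 23)] -/
theorem stub_IIb_homScheme_holds : ∀ ⦃S Y X : Scheme.{0}⦄ [IsLocallyNoetherian S] (q : Y ⟶ S) (p : X ⟶ S) [Flat q]
    (_ : IsProjective q) (_ : IsProjective p),
    ∃ (M : Scheme.{0}) (m : M ⟶ S) (_ : IsLocallyNoetherian M) (_ : IsSeparated m) (_ : LocallyOfFiniteType m)
      (u : pullback q m ⟶ pullback p m) (_ : u ≫ pullback.snd p m = pullback.snd q m),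
      ∀ ⦃T : Scheme.{0}⦄ [IsLocallyNoetherian T] (v : T ⟶ S) (φ : pullback q v ⟶ pullback p v)
        (hφ : φ ≫ pullback.snd p v = pullback.snd q v),
        ∃! w : T ⟶ M, ∃ (hw : w ≫ m = v),
          φ ≫ pullback.map p v p m (𝟙 X) w (𝟙 S) (by simp) (by simpa using hw.symm) =
            pullback.map q v q m (𝟙 Y) w (𝟙 S) (by simp) (by simpa using hw.symm) ≫ u := by
  intro S Y X _ q p _ hq hp
  -- (A) the embedding
  obtain ⟨ι, _, hn, jW, hjW, hjWfst⟩ := stub_IIb4A_embedding q p hq hp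
  -- (B) the pieces, for every admissible polynomial (choice)
  have hB := fun Q : {Q : ℚ[X] // ∀ e : ℕ, regularityBound (preHilbertPoly ℚ (Nat.card ι) 0) 0
      (preHilbertPoly ℚ (Nat.card ι) 0 - Q) - 1 ≤ (e : ℤ) → ((⌊Q.eval (e : ℚ)⌋₊ : ℕ) : ℚ) = Q.eval (e : ℚ)} =>
    stub_IIb4B_piece q p hq hp hn jW hjWfst Q.1 Q.2
  choose M_ m_ hMn hMs hMl u_ hu_ hB' using hB
  -- (D) gluing, fed by (B) and the decomposition (C)
  exact stub_IIb4D_gluing q p hq hp hn jW hjWfst M_ m_ hMn hMs hMl u_ hu_ hB'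
    (fun T _ v φ hφ hw iΓ h₁ h₂ => stub_IIb4C_decomposition q p hn jW hjWfst v φ hφ hw iΓ h₁ h₂)

end Summit.HodgeConjecture.CorCM.Cruxes.HypDel.F4LinearRigidificationII.IIbHomScheme

end
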